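import Mathlib
import Summits.MatrixMultiplication.MatrixMultiplication.Theorems.SnSubsetDichotomyHyperoctahedralThresholdCleanPairAssembly
import Summits.MatrixMultiplication.MatrixMultiplication.Theorems.SnSubsetDichotomyHyperoctahedralThresholdCleanPairParams
import Summits.MatrixMultiplication.MatrixMultiplication.Theorems.SnSubsetDichotomyHyperoctahedralThresholdCleanPairGlue
import Summits.MatrixMultiplication.MatrixMultiplication.Theorems.SnSubsetDichotomyHyperoctahedralThresholdSelfCleanDarts

/-!
# The clean-pair atom, and `stub_poorRigidCore` (crux `HyperoctahedralThreshold`, stmt-MatrixMultiplication-10883)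

`stub_cleanPairAtom` (registered): for `n ≥ n₀` and three fixed-point-free involutions, every `R` with `|R| ≤ n^(3/4)` in a POOR
host admits, at some root `v ≠ x` and depth `a` with `2a ≤ ⌊n^(1/4)⌋`, two distinct colliding reduced words of length `a` whose
trajectories avoid `R` and whose rungs are pairwise equal / swapped / disjoint.  Proof = scale parameters (`stub_atomParams`) +
POOR made uniform over reduced words (`SelfCleanDarts.poor_uniform` at `L = 2a`) + the depth recursion (`stub_cleanPairOfParams`).
RIGID is not used.  `stub_poorRigidCore` — THE open stub of the registered skeleton `Lines/refutation_local_symmetry.lean` — follows by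
the landed glue `stub_poorRigidCoreOfCleanPair` (p128553).  Proof plan: `Cruxes/HyperoctahedralThreshold/Lines/stub_plan_poorRigidCore.md`.
-/

-- the tree's namespace `Summit.MatrixMultiplication.MatrixMultiplication.…` repeats a component by design
set_option linter.dupNamespace false

namespace Summit.MatrixMultiplication.MatrixMultiplication.Theorems.HyperoctahedralThreshold

/-- **`stub_cleanPairAtom`** (registered): the clean-pair atom of the line `stub_poorRigidCore`. -/
theorem stub_cleanPairAtom : ∃ n₀ : ℕ, ∀ n ≥ n₀, ∀ μ : Fin 3 → Equiv.Perm (Fin n), (∀ i, μ i * μ i = 1 ∧ ∀ v, μ i v ≠ v) → ∀ R : Finset (Fin n), (R.card : ℝ) ≤ (n : ℝ) ^ ((3 : ℝ) / 4) → (∀ z : List (Fin 3), z ≠ [] → List.IsChain (· ≠ ·) (z ++ z) → (z.length : ℝ) ≤ (n : ℝ) ^ ((1 : ℝ) / 4) → ∀ (m : ℕ) (x : Fin m → Fin n), Function.Injective x → (∀ i, z.foldl (fun v c => μ c v) (x i) = x i) → m ≤ (4 * z.length ^ 2) ^ (Nat.log 2 z.length + 1) * (R.card + 1)) → (∀ z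 : List (Fin 3), z ≠ [] → List.IsChain (· ≠ ·) (z ++ z) → (z.length : ℝ) ≤ (n : ℝ) ^ ((1 : ℝ) / 4) → ∀ (m : ℕ) (x : Fin m → Fin n), Function.Injective x → (∀ i, z.foldl (fun v c => μ c v) (x i) = x i) → (∀ i j, ∀ s t : Fin z.length, ((z.take (s : ℕ)).foldl (fun v c => μ c v) (x i) = (z.take (t : ℕ)).foldl (fun v c => μ c v) (x i) ↔ (z.take (s : ℕ)).foldl (fun v c => μ c v) (x j) = (z.take (t : ℕ)).foldl (fun v c => μ c v) (x j))) → m ≤ 2 * (z.length * R.card) + z.length ^ 2 + 1) → (∃ (k : ℕ) (p q : Fin (k + 1) → Fin n) (col : Fin (k + 1) → Fin 3), (∀ i, p i ≠ q i) ∧ (∀ i, (μ (col i) (p i) = p (i + 1) ∧ μ (col i) (q i) = q (i + 1)) ∨ (μ (col i) (p i) = q (i + 1) ∧ μ (col i) (q i) = p (i + 1))) ∧ (∀ i, col i ≠ col (i + 1)) ∧ (∀ i j, (p i = p j ∧ q i = q j) ∨ (p i = q j ∧ q i = p j) ∨ (p i ≠ p j ∧ p i ≠ q j ∧ q i ≠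 p j ∧ q i ≠ q j)) ∧ (∀ i, p i ∉ R ∧ q i ∉ R) ∧ ((k : ℝ) + 1) ≤ (n : ℝ) ^ ((1 : ℝ) / 4)) ∨ ∃ (a : ℕ) (v x : Fin n) (β β' : List (Fin 3)), 2 * a ≤ ⌊(n : ℝ) ^ ((1 : ℝ) / 4)⌋₊ ∧ v ≠ x ∧ β.length = a ∧ β'.length = a ∧ β ≠ β' ∧ List.IsChain (· ≠ ·) β ∧ List.IsChain (· ≠ ·) β' ∧ β.foldl (fun v b => μ b v) v = β'.foldl (fun v b => μ b v) v ∧ β.foldl (fun v b => μ b v) x = β'.foldl (fun v b => μ b v) x ∧ (∀ t ≤ a, (β.take t).foldl (fun v b => μ b v) v ∉ R ∧ (β.take t).foldl (fun v b => μ b v) x ∉ R ∧ (β'.take t).foldl (fun v b => μ b v) v ∉ R ∧ (β'.take t).foldl (fun v b => μ b v) x ∉ R) ∧ (∀ γ γ' : List (Fin 3), (γ = β ∨ γ = β') → (γ' = β ∨ γ' = β') → ∀ s ≤ a, ∀ t ≤ a, ((γ.take s).foldl (fun v b => μ b v) v = (γ'.take t).foldl (fun v b => μ b v) v ∧ (γ.take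 s).foldl (fun v b => μ b v) x = (γ'.take t).foldl (fun v b => μ b v) x) ∨ ((γ.take s).foldl (fun v b => μ b v) v = (γ'.take t).foldl (fun v b => μ b v) x ∧ (γ.take s).foldl (fun v b => μ b v) x = (γ'.take t).foldl (fun v b => μ b v) v) ∨ ((γ.take s).foldl (fun v b => μ b v) v ≠ (γ'.take t).foldl (fun v b => μ b v) v ∧ (γ.take s).foldl (fun v b => μ b v) v ≠ (γ'.take t).foldl (fun v b => μ b v) x ∧ (γ.take s).foldl (fun v b => μ b v) x ≠ (γ'.take t).foldl (fun v b => μ b v) v ∧ (γ.take s).foldl (fun v b => μ b v) x ≠ (γ'.take t).foldl (fun v b => μ b v) x)) := by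
  obtain ⟨n₀, hn₀⟩ := stub_atomParams
  refine ⟨n₀, fun n hn μ hμ R hR hpoor _ => Or.inr ?_⟩
  obtain ⟨ha, hn2, hra, hs₀, h2a, hfloor, hr, ht₁, hΛ, hC, hB, hdepth, hD₀, hdmin, hstart, htyp⟩ := hn₀ n hn R.card hR
  have hΦ₀ := SelfCleanDarts.poor_uniform μ hμ R hpoor (2 * (2 ^ 26 * (Nat.log 2 n + 1) ^ 2)) h2a
  obtain ⟨v, x, β, β', hvx, hl, hl', hne, hc, hc', hcv, hcx, hRfree, heod⟩ :=
    stub_cleanPairOfParams n _ _ _ _ 21 _ _ _ _ μ R (fun c => (hμ c).1) ha hn2 hra hs₀ hΦ₀ hr ht₁ hΛ hC hB hdepth hD₀ hdmin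
      hstart htyp
  exact ⟨_, v, x, β, β', hfloor, hvx, hl, hl', hne, hc, hc', hcv, hcx, hRfree, heod⟩

/-- **`stub_poorRigidCore`** (registered; the open stub of `Lines/refutation_local_symmetry.lean:271`, 1345 chars): in the poor rigid
regime every forbidden set of size `≤ n^(3/4)` is avoided by some clean closed rung walk of `≤ n^(1/4)` rungs.  PROVED: the clean-pair atom
(`stub_cleanPairAtom`) through the glue `stub_poorRigidCoreOfCleanPair` (p128553) and the extraction `stub_goodCollisionWalk` (p128095). -/
theorem stub_poorRigidCore : ∃ n₀ : ℕ, ∀ n ≥ n₀, ∀ μ : Fin 3 → Equiv.Perm (Fin n), (∀ i, μ i * μ i = 1 ∧ ∀ v, μ i v ≠ v) → ∀ R : Finset (Fin n), (R.card : ℝ) ≤ (n : ℝ) ^ ((3 : ℝ) / 4) → (∀ z : List (Fin 3), z ≠ [] → List.IsChain (· ≠ ·) (z ++ z) → (z.length : ℝ) ≤ (n : ℝ) ^ ((1 : ℝ) / 4) → ∀ (m : ℕ) (x : Fin m → Fin n), Function.Injective x → (∀ i, z.foldl (fun v c => μ c v) (x i) = x i) → m ≤ (4 * z.length ^ 2)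 ^ (Nat.log 2 z.length + 1) * (R.card + 1)) → (∀ z : List (Fin 3), z ≠ [] → List.IsChain (· ≠ ·) (z ++ z) → (z.length : ℝ) ≤ (n : ℝ) ^ ((1 : ℝ) / 4) → ∀ (m : ℕ) (x : Fin m → Fin n), Function.Injective x → (∀ i, z.foldl (fun v c => μ c v) (x i) = x i) → (∀ i j, ∀ s t : Fin z.length, ((z.take (s : ℕ)).foldl (fun v c => μ c v) (x i) = (z.take (t : ℕ)).foldl (fun v c => μ c v) (x i) ↔ (z.take (s : ℕ)).foldl (fun v c => μ c v) (x j) = (z.take (t : ℕ)).foldl (fun v c => μ c v) (x j))) → m ≤ 2 * (z.length * R.card) + z.length ^ 2 + 1) → ∃ (k : ℕ) (p q : Fin (k + 1) → Fin n) (col : Fin (k + 1) → Fin 3), (∀ i, p i ≠ q i) ∧ (∀ i, (μ (col i) (p i) = p (i + 1) ∧ μ (col i) (q i) = q (i + 1)) ∨ (μ (col i) (p i) = q (i + 1) ∧ μ (col i) (q i) = p (i + 1))) ∧ (∀ i, col i ≠ col (i + 1)) ∧ (∀ i j, (p i = p j ∧ q i = q j) ∨ (p i = q j ∧ q i = p j)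 ∨ (p i ≠ p j ∧ p i ≠ q j ∧ q i ≠ p j ∧ q i ≠ q j)) ∧ (∀ i, p i ∉ R ∧ q i ∉ R) ∧ ((k : ℝ) + 1) ≤ (n : ℝ) ^ ((1 : ℝ) / 4) :=
  stub_poorRigidCoreOfCleanPair stub_cleanPairAtom

end Summit.MatrixMultiplication.MatrixMultiplication.Theorems.HyperoctahedralThreshold
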